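import Literature.Probability.LatticeModels.DoubleCurrentsLimit
import Literature.Probability.LatticeModels.CurrentsAvoidShift
import HarnessLib

/-!
# ADS15 Thm. 2.3 (R2): translation invariance of the infinite-volume double current — proof

Trunk G02 (T-STATMECH), topic `Probability/LatticeModels`; namespaces `Literature.StatMech` (lemmas) and
`Literature.CritIsing` (the discharge). This file **discharges the named fact
`Literature.Probability.LatticeModels.ads_doubleCurrent_shift_invariant`** (`DoubleCurrentsInfinite.lean`), ADS15 Thm. 2.3
(R2) with §2.3 for the double current of the nearest-neighbour model:

* M. Aizenman, H. Duminil-Copin, V. Sidoravicius, *Random currents and continuity of Ising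
  model's spontaneous magnetization*, Comm. Math. Phys. **334** (2015) 719–742, proof of Thm. 2.3,
  R2 (arXiv:1311.1937v3; bib key `AizenmanDuminilCopinSidoraviciusCMP2015`): "The limit of the
  probability of the event `𝒞_E` … is the same if the sequence `(Λ_L)` is replaced by the sequence
  `(x + Λ_L)`. (Simply use (2.14) and the convergence of `⟨⋯⟩^#_{x+Λ_L,β}` to `⟨⋯⟩^#_β`.) This
  immediately implies that `P̂^#_β` is invariant under translations."

## Proof

The limit laws `q(F,U) = lim_L ℙ_{Λ_L,β}[ω ∩ F = U]` of `DoubleCurrentsLimit.lean` are explicit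
finite combinations (inclusion–exclusion) of the edge-avoidance limits of
`CurrentsEdgeAvoidance.lean` ((2.14)), which are translation invariant
(`CurrentsAvoidShift.lean`, from `IsingTranslationInvariance.lean`); hence `q(F+v, U+v) = q(F,U)`
(`adsTraceLimitGen_image_pairShift`).
Consequently the translate `μ ∘ τ_v⁻¹` of an infinite-volume double current `μ` (`IsAdsLimit d β μ`)
is again one (`IsAdsLimit.map_bondShift`), and the limit is unique (`IsAdsLimit.unique`).

## Mathlib status

Anchors: `Finset.image`, `Finset.image_sdiff`, `Finset.image_union`, `MeasurableEquiv.map_apply`;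
tree: `BondConfig.relabel`, `sym2Equiv`, `mk_add_mem_relabel_shift_iff`
(`BondPercolationSymmetry.lean`), `pairShift`, `plusCurrentAvoidLimit_image_pairShift`,
`freeCurrentAvoidLimit_image_pairShift` (`CurrentsAvoidShift.lean`),
`ads_doubleCurrent_limit_exists_holds` (`DoubleCurrentsLimit.lean`).
-/

noncomputable section

open MeasureTheory Filter Topology Finset Literature.Probability.LatticeModels Literature.Probability.Percolation
open scoped symmDiff ENNReal

namespace Literature.Probability.LatticeModels

variable (d : ℕ)

/-! ### Translation invariance of the limit laws -/

/-- Translation commutes with the set operations of inclusion–exclusion. [folklore] -/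
theorem image_sdiff_union (v : Site d) (F U W : Finset (Sym2 (Site d))) :
    (F.image (pairShift d v) \ U.image (pairShift d v)) ∪ W.image (pairShift d v) =
      ((F \ U) ∪ W).image (pairShift d v) := by
  rw [Finset.image_union, Finset.image_sdiff _ _ (pairShift_injective d v)]

/-- `lim_L P̂⁺_{Λ_L,β}[n̂ ∩ F = U]` is translation invariant (`β ≥ 0`). [cite: AizenmanDuminilCopinSidoraviciusCMP2015, Thm. 2.3 (R2), proof] -/
theorem plusCurrentTraceLimit_image_pairShift {β : ℝ} (hβ : 0 ≤ β) (v : Site d) (F U : Finset (Sym2 (Site d))) :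
    plusCurrentTraceLimit d β (F.image (pairShift d v)) (U.image (pairShift d v)) = plusCurrentTraceLimit d β F U := by
  unfold plusCurrentTraceLimit
  rw [sum_powerset_image_pairShift]
  refine Finset.sum_congr rfl fun W _ => ?_
  rw [Finset.card_image_of_injective _ (pairShift_injective d v), image_sdiff_union,
    plusCurrentAvoidLimit_image_pairShift d hβ]

/-- `lim_L P̂⁰_{Λ_L,β}[n̂ ∩ F = U]` is translation invariant (`β ≥ 0`). [cite: AizenmanDuminilCopinSidoraviciusCMP2015, Thm. 2.3 (R2), proof] -/
theorem freeCurrentTraceLimit_image_pairShift {β : ℝ} (hβ : 0 ≤ β) (v : Site d) (F U : Finset (Sym2 (Site d))) :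
    freeCurrentTraceLimit d β (F.image (pairShift d v)) (U.image (pairShift d v)) = freeCurrentTraceLimit d β F U := by
  unfold freeCurrentTraceLimit
  rw [sum_powerset_image_pairShift]
  refine Finset.sum_congr rfl fun W _ => ?_
  rw [Finset.card_image_of_injective _ (pairShift_injective d v), image_sdiff_union,
    freeCurrentAvoidLimit_image_pairShift d hβ]

/-- `lim_L ℙ_{Λ_L,β}[ω ∩ F = U]` is translation invariant for lattice `F` (`β ≥ 0`). [cite: AizenmanDuminilCopinSidoraviciusCMP2015, Thm. 2.3 (R2) and §2.3] -/
theorem adsTraceLimit_image_pairShift {β : ℝ} (hβ : 0 ≤ β) (v : Site d) (F U : Finset (Sym2 (Site d))) :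
    adsTraceLimit d β (F.image (pairShift d v)) (U.image (pairShift d v)) = adsTraceLimit d β F U := by
  unfold adsTraceLimit
  rw [sum_powerset_image_pairShift]
  refine Finset.sum_congr rfl fun U₁ _ => ?_
  rw [sum_powerset_image_pairShift]
  refine Finset.sum_congr rfl fun U₂ _ => ?_
  have hiff : U₁.image (pairShift d v) ∪ U₂.image (pairShift d v) = U.image (pairShift d v) ↔
      U₁ ∪ U₂ = U := by
    rw [← Finset.image_union, Finset.image_inj (pairShift_injective d v)]
  by_cases hU : U₁ ∪ U₂ = U
  · rw [if_pos (hiff.2 hU), if_pos hU, freeCurrentTraceLimit_image_pairShift d hβ,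
      plusCurrentTraceLimit_image_pairShift d hβ]
  · rw [if_neg (fun h => hU (hiff.1 h)), if_neg hU]

/-- Translation commutes with taking the lattice part. [folklore] -/
theorem filter_mem_edgeSet_image_pairShift (v : Site d) (F : Finset (Sym2 (Site d))) :
    (F.image (pairShift d v)).filter (· ∈ (zdGraph d).edgeSet) =
      (F.filter (· ∈ (zdGraph d).edgeSet)).image (pairShift d v) := by
  rw [Finset.filter_image]
  congr 1
  refine Finset.filter_congr fun e _ => ?_
  exact pairShift_mem_edgeSet_iff d v e

/-- **The limit laws are translation invariant**: `q(F + v, U + v) = q(F,U)` (`β ≥ 0`)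
(ADS15 proof of Thm. 2.3, R2, with §2.3; here from (2.14) and the translation invariance of
`⟨σ_A⟩⁺_β`, `⟨σ_A⟩⁰_β`). [cite: AizenmanDuminilCopinSidoraviciusCMP2015, Thm. 2.3 (R2) and §2.3] -/
theorem adsTraceLimitGen_image_pairShift {β : ℝ} (hβ : 0 ≤ β) (v : Site d) (F U : Finset (Sym2 (Site d))) :
    adsTraceLimitGen d β (F.image (pairShift d v)) (U.image (pairShift d v)) = adsTraceLimitGen d β F U := by
  unfold adsTraceLimitGen
  have hinj := pairShift_injective d v
  have hcond : (∀ e ∈ F.image (pairShift d v), e ∉ (zdGraph d).edgeSet → e ∉ U.image (pairShift d v)) ↔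
      (∀ e ∈ F, e ∉ (zdGraph d).edgeSet → e ∉ U) := by
    constructor
    · intro h e he heE heU
      exact h _ (Finset.mem_image_of_mem _ he) (fun h' => heE ((pairShift_mem_edgeSet_iff d v e).1 h'))
        (Finset.mem_image_of_mem _ heU)
    · intro h e' he' he'E he'U
      obtain ⟨e, he, rfl⟩ := Finset.mem_image.1 he'
      have heU : e ∈ U := hinj.mem_finset_image.1 he'U
      exact h e he (fun heE => he'E ((pairShift_mem_edgeSet_iff d v e).2 heE)) heU
  by_cases hc : ∀ e ∈ F, e ∉ (zdGraph d).edgeSet → e ∉ U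
  · rw [if_pos (hcond.2 hc), if_pos hc, filter_mem_edgeSet_image_pairShift,
      filter_mem_edgeSet_image_pairShift, adsTraceLimit_image_pairShift d hβ]
  · rw [if_neg (fun h => hc (hcond.1 h)), if_neg hc]

/-! ### Translating bond configurations and cylinders -/

/-- **Translates of cylinders**: `τ_v⁻¹ {ω ∩ (F+v) = U+v} = {ω ∩ F = U}`. [folklore] -/
theorem preimage_bondShift_localCylinder (v : Site d) (F U : Finset (Sym2 (Site d))) :
    bondShift d v ⁻¹' localCylinder (↑(F.image (pairShift d v)) : Set (Sym2 (Site d))) ↑(U.image (pairShift d v)) =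
      localCylinder (↑F : Set (Sym2 (Site d))) ↑U := by
  have hinj := pairShift_injective d v
  ext ω
  simp only [Set.mem_preimage, mem_localCylinder_coe_iff]
  constructor
  · intro h e he
    have h1 := h (pairShift d v e) (Finset.mem_image_of_mem _ he)
    rw [hinj.mem_finset_image] at h1
    rw [h1]
    induction e using Sym2.ind with
    | _ x y => exact mk_add_mem_relabel_shift_iff v ω x y
  · intro h e' he'
    obtain ⟨e, he, rfl⟩ := Finset.mem_image.1 he'
    rw [hinj.mem_finset_image, h e he]
    induction e using Sym2.ind with
    | _ x y => exact (mk_add_mem_relabel_shift_iff v ω x y).symm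

/-- Translating by `-v` and then by `v` is the identity on finite sets of pairs. [folklore] -/
theorem image_pairShift_neg_image (v : Site d) (F : Finset (Sym2 (Site d))) :
    (F.image (pairShift d (-v))).image (pairShift d v) = F := by
  rw [Finset.image_image]
  conv_rhs => rw [← Finset.image_id (s := F)]
  congr 1
  funext e
  have h := pairShift_neg_pairShift d (-v) e
  rw [neg_neg] at h
  exact h

/-- An infinite-volume double current charges the cylinders with the limit laws `q(F,U)`. [cite: AizenmanDuminilCopinSidoraviciusCMP2015, Thm. 2.3 (R1)] -/
theorem IsAdsLimit.real_localCylinder {β : ℝ} (hβ : 0 ≤ β) {μ : Measure (BondConfig (Site d))}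
    (hμ : IsAdsLimit d β μ) {F U : Finset (Sym2 (Site d))} (hUF : U ⊆ F) :
    μ.real (localCylinder (↑F : Set (Sym2 (Site d))) ↑U) = adsTraceLimitGen d β F U :=
  tendsto_nhds_unique (hμ.tendsto_local _ (isLocalEvent_localCylinder F ↑U))
    (tendsto_adsDoubleCurrentLaw_localCylinder d hβ hUF)

open Classical in
/-- **The translate of an infinite-volume double current is an infinite-volume double current**
(`β ≥ 0`): on a local event `A` determined by `F`,
`μ(τ_v⁻¹ A) = ∑_{U ⊆ F, U ∈ A} μ(τ_v⁻¹{ω ∩ F = U}) = ∑ q(F - v, U - v) = ∑ q(F,U) = lim_L ℙ_{Λ_L,β}(A)`. [cite: AizenmanDuminilCopinSidoraviciusCMP2015, Thm. 2.3 (R2) and §2.3] -/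
theorem IsAdsLimit.map_bondShift {β : ℝ} (hβ : 0 ≤ β) {μ : Measure (BondConfig (Site d))}
    (hμ : IsAdsLimit d β μ) (v : Site d) : IsAdsLimit d β (μ.map (bondShift d v)) := by
  haveI := hμ.isProbabilityMeasure
  haveI : IsProbabilityMeasure (μ.map (bondShift d v)) :=
    Measure.isProbabilityMeasure_map (bondShift d v).measurable.aemeasurable
  refine ⟨inferInstance, ?_⟩
  rintro A ⟨F, hF⟩
  -- decompose `A` into cylinders and translate each back
  set F₀ := F.image (pairShift d (-v)) with hF₀
  have hpre : ∀ U : Finset (Sym2 (Site d)),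
      bondShift d v ⁻¹' localCylinder (↑F : Set (Sym2 (Site d))) ↑U =
        localCylinder (↑F₀ : Set (Sym2 (Site d))) ↑(U.image (pairShift d (-v))) := by
    intro U
    have h := preimage_bondShift_localCylinder d v F₀ (U.image (pairShift d (-v)))
    rwa [hF₀, image_pairShift_neg_image, image_pairShift_neg_image] at h
  have hreal : (μ.map (bondShift d v)).real A =
      ∑ U ∈ F.powerset.filter (fun U : Finset (Sym2 (Site d)) => (↑U : Set (Sym2 (Site d))) ∈ A),
        adsTraceLimitGen d β F U := by
    rw [measureReal_eq_sum_localCylinder d (μ.map (bondShift d v)) hF]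
    refine Finset.sum_congr rfl fun U hU => ?_
    have hUF : U ⊆ F := Finset.mem_powerset.1 (Finset.mem_of_mem_filter U hU)
    rw [measureReal_def, MeasurableEquiv.map_apply, hpre U, ← measureReal_def,
      hμ.real_localCylinder d hβ (Finset.image_subset_image hUF)]
    have h := adsTraceLimitGen_image_pairShift d hβ v F₀ (U.image (pairShift d (-v)))
    rw [hF₀, image_pairShift_neg_image, image_pairShift_neg_image] at h
    rw [← h]
  rw [hreal]
  have hLsum : ∀ L : ℕ, (adsDoubleCurrentLaw d L β).real A =
      ∑ U ∈ F.powerset.filter (fun U : Finset (Sym2 (Site d)) => (↑U : Set (Sym2 (Site d))) ∈ A),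
        (adsDoubleCurrentLaw d L β).real (localCylinder (↑F : Set (Sym2 (Site d))) ↑U) := by
    intro L
    haveI := isProbabilityMeasure_adsDoubleCurrentLaw d L hβ
    exact measureReal_eq_sum_localCylinder d _ hF
  simp_rw [hLsum]
  exact tendsto_finsetSum _ fun U hU =>
    tendsto_adsDoubleCurrentLaw_localCylinder d hβ (Finset.mem_powerset.1 (Finset.mem_of_mem_filter U hU))

end Literature.Probability.LatticeModels

namespace Literature.Probability.LatticeModels

open Percolation

variable {d : ℕ}

/-- **ADS15 Thm. 2.3 (R2) with §2.3 for the double current, proved** (Aizenman–Duminil-Copin–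
Sidoravicius, CMP 334 (2015)): discharge of the named fact `ads_doubleCurrent_shift_invariant` of
`DoubleCurrentsInfinite.lean` — for `β > 0` the infinite-volume double current
`ℙ_β = adsDoubleCurrentLawInf d β` is invariant under every lattice translation (its translate is
again the limit of the box double currents, and the limit is unique). [cite: AizenmanDuminilCopinSidoraviciusCMP2015, Thm. 2.3 (R2) and §2.3] -/
theorem ads_doubleCurrent_shift_invariant_holds : ads_doubleCurrent_shift_invariant (d := d) := by
  intro β hβ v
  have hlim := isAdsLimit_adsDoubleCurrentLawInf d (ads_doubleCurrent_limit_exists_holds hβ)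
  exact ((hlim.map_bondShift d hβ.le v).unique d hlim)

/-- **The exit probability vanishes, granted ADS15 Thm. 3.1** (R1 and R2 being proved): the named
fact `ads_exitProb_tendsto_zero_of_lroTildeSq` (`DoubleCurrents.lean`, ADS15 §3.2, remark after
(3.11)) follows from `ads_percolatesAt_zero_of_lroTildeSq` alone. [cite: AizenmanDuminilCopinSidoraviciusCMP2015, §3.2, remark after eq. (3.11)] -/
theorem ads_exitProb_tendsto_zero_of_lroTildeSq_of_thm31
    (h31 : ads_percolatesAt_zero_of_lroTildeSq (d := d)) :
    ads_exitProb_tendsto_zero_of_lroTildeSq (d := d) :=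
  ads_exitProb_tendsto_zero_of_lroTildeSq_of_infinite ads_doubleCurrent_limit_exists_holds
    ads_doubleCurrent_shift_invariant_holds h31

end Literature.Probability.LatticeModels
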